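import Mathlib
import Literature.Probability.Process.PointStationaryLaw
import Literature.Probability.Process.RootedHardCoreConfig

/-!
# Giry measurability of a rooted isometry class (stub S2 of line `Sketch`)

Crux `IsometryAtoms.AtomicLawChargesCrystal` (stmt-AtomisticToContinuum-15778), line `Sketch`,
registered stub `stub_measurableSet_isometryClass`: for a Delone set `D ⊆ ℝ³` and any `q`, the
rooted isometry class `{count|A(D − q) : A a linear isometry}` is a measurable set of measures for
Mathlib's Giry σ-algebra `MeasureTheory.Measure.instMeasurableSpace`.

Proof.  `μ` lies in the class iff
* (a) `μ (closedBall 0 n) = count (D ∩ closedBall q n)` for every `n : ℕ`, and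
* (b) for every `k : ℕ` some `T` in a COUNTABLE dense family of linear isometries (inside the
  second-countable operator space `E →L[ℝ] E`) has `1 ≤ μ (ball (T (s - q)) (1/(k+1)))` for all
  `s ∈ D ∩ closedBall q k`.
Both are countably many evaluation conditions, hence measurable (`Measure.measurable_coe`).  The
converse direction extracts a convergent subsequence of the `T k` (isometries form a closed bounded,
hence compact, subset of the proper space `E →L[ℝ] E`), shows that every limit point `A (s - q)`
is an atom of mass `≥ 1` (continuity from above on the finite measures `μ|closedBall 0 n`), and
identifies `μ` with `count|A(D − q)` ball by ball (a finite set of atoms of mass `≥ 1` whose total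
mass is the number of atoms carries exactly the counting measure).
-/

noncomputable section

namespace Summit.AtomisticToContinuum.Crystallization.Theorems.IsometryAtomsAtomicLawChargesCrystal

open MeasureTheory Metric Filter Topology Set

/-! ### Measure-theoretic lemmas: finitely many heavy atoms -/

/-- If every point of a finite set `Q` is an atom of mass `≥ 1` of `μ`, then `count Q ≤ μ Q`. -/
theorem s2_count_le_of_forall_one_le {α : Type*} [MeasurableSpace α] [MeasurableSingletonClass α]
    (μ : Measure α) {Q : Set α} (hQ : Q.Finite) (h1 : ∀ p ∈ Q, 1 ≤ μ {p}) :
    Measure.count Q ≤ μ Q := by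
  rw [Measure.count_apply_finite Q hQ]
  calc ((hQ.toFinset.card : ℕ) : ENNReal) = ∑ _p ∈ hQ.toFinset, (1 : ENNReal) := by simp
    _ ≤ ∑ p ∈ hQ.toFinset, μ {p} :=
        Finset.sum_le_sum fun p hp => h1 p (hQ.mem_toFinset.1 hp)
    _ = μ Q := by rw [sum_measure_singleton, hQ.coe_toFinset]

/-- **Finitely many heavy atoms of the right total mass carry the counting measure.**  If a finite
set `P ⊆ B` of atoms of mass `≥ 1` of `μ` has `μ B = count P`, then `μ|B = count|P`. -/
theorem s2_restrict_eq_count_restrict {α : Type*} [MeasurableSpace α] [MeasurableSingletonClass α]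
    (μ : Measure α) {B P : Set α} (hP : P.Finite) (hPB : P ⊆ B)
    (h1 : ∀ p ∈ P, 1 ≤ μ {p}) (hμ : μ B = Measure.count P) :
    μ.restrict B = Measure.count.restrict P := by
  ext t ht
  rw [Measure.restrict_apply ht, Measure.restrict_apply ht, Set.inter_comm t B, Set.inter_comm t P]
  have key : ∀ u : Set α, Measure.count (P ∩ u) ≤ μ (B ∩ u) := fun u =>
    (s2_count_le_of_forall_one_le μ (hP.inter_of_left u) fun p hp => h1 p hp.1).trans
      (measure_mono (Set.inter_subset_inter_left u hPB))
  refine le_antisymm (not_lt.1 fun hlt => ?_) (key t)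
  have hc : Measure.count (P \ t) ≠ ⊤ :=
    ((measure_mono Set.sdiff_subset).trans_lt (Measure.count_apply_lt_top.2 hP)).ne
  have hlt2 : Measure.count (P ∩ t) + Measure.count (P \ t) < μ (B ∩ t) + μ (B \ t) :=
    ENNReal.add_lt_add_of_lt_of_le hc hlt (by rw [Set.sdiff_eq, Set.sdiff_eq]; exact key tᶜ)
  rw [measure_inter_add_sdiff _ ht, measure_inter_add_sdiff _ ht, hμ] at hlt2
  exact lt_irrefl _ hlt2

/-- **Continuity from above at a point**: if all small closed balls around `p` have `μ`-mass
`≥ 1` and the unit ball has finite mass, then `p` is an atom of mass `≥ 1`. -/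
theorem s2_one_le_measure_singleton {X : Type*} [MetricSpace X] [MeasurableSpace X]
    [OpensMeasurableSpace X] (μ : Measure X) (p : X) (hfin : μ (closedBall p 1) ≠ ⊤)
    (h : ∀ m : ℕ, 1 ≤ μ (closedBall p (1 / ((m : ℝ) + 1)))) : 1 ≤ μ {p} := by
  have hset : ({p} : Set X) = ⋂ m : ℕ, closedBall p (1 / ((m : ℝ) + 1)) := by
    ext y
    simp only [Set.mem_singleton_iff, Set.mem_iInter, Metric.mem_closedBall]
    constructor
    · rintro rfl m
      rw [dist_self]
      positivity
    · intro hy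
      by_contra hne
      obtain ⟨m, hm⟩ := exists_nat_one_div_lt (dist_pos.2 hne)
      exact lt_irrefl _ (hm.trans_le (hy m))
  rw [hset, Antitone.measure_iInter]
  · exact le_iInf h
  · intro m n hmn
    refine closedBall_subset_closedBall (one_div_le_one_div_of_le (by positivity) ?_)
    exact_mod_cast Nat.succ_le_succ hmn
  · exact fun m => measurableSet_closedBall.nullMeasurableSet
  · exact ⟨0, by simpa using hfin⟩

/-! ### Geometry of `ℝ³`: Delone patches, isometric images, the compact isometry group -/

/-- A Delone set meets every closed ball in a finite set. -/
theorem s2_finite_inter (D : Delone.DeloneSet (EuclideanSpace ℝ (Fin 3)))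
    (q : EuclideanSpace ℝ (Fin 3)) (r : ℝ) :
    ((D : Set (EuclideanSpace ℝ (Fin 3))) ∩ closedBall q r).Finite := by
  have h := Literature.Probability.Process.LocalConfig.finite_inter_of_separated
    (S := (D : Set (EuclideanSpace ℝ (Fin 3)))) (δ := (D.packingRadius : ℝ))
    (NNReal.coe_pos.2 D.packingRadius_pos)
    (fun x hx y hy hxy => (D.packingRadius_lt_dist_of_mem_ne hx hy hxy).le)
    (isCompact_closedBall q r)
  rwa [Set.inter_comm] at h

/-- The part of the rooted isometric image `A (Y - q)` inside `closedBall 0 r` is the image of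
the patch `Y ∩ closedBall q r`. -/
theorem s2_image_inter (Y : Set (EuclideanSpace ℝ (Fin 3))) (q : EuclideanSpace ℝ (Fin 3))
    (A : EuclideanSpace ℝ (Fin 3) →ₗᵢ[ℝ] EuclideanSpace ℝ (Fin 3)) (r : ℝ) :
    closedBall (0 : EuclideanSpace ℝ (Fin 3)) r ∩ ((fun s => A (s - q)) '' Y) =
      (fun s => A (s - q)) '' (Y ∩ closedBall q r) := by
  ext y
  constructor
  · rintro ⟨hy, s, hs, rfl⟩
    refine ⟨s, ⟨hs, mem_closedBall.2 ?_⟩, rfl⟩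
    rw [mem_closedBall_zero_iff, A.norm_map, ← dist_eq_norm] at hy
    exact hy
  · rintro ⟨s, ⟨hs, hsq⟩, rfl⟩
    refine ⟨mem_closedBall_zero_iff.2 ?_, s, hs, rfl⟩
    rw [A.norm_map, ← dist_eq_norm]
    exact mem_closedBall.1 hsq

/-- Counting the rooted isometric image inside `closedBall 0 r` counts the patch
`Y ∩ closedBall q r`. -/
theorem s2_count_image_inter (Y : Set (EuclideanSpace ℝ (Fin 3))) (q : EuclideanSpace ℝ (Fin 3))
    (A : EuclideanSpace ℝ (Fin 3) →ₗᵢ[ℝ] EuclideanSpace ℝ (Fin 3)) (r : ℝ) :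
    Measure.count (closedBall (0 : EuclideanSpace ℝ (Fin 3)) r ∩ ((fun s => A (s - q)) '' Y)) =
      Measure.count (Y ∩ closedBall q r) := by
  rw [s2_image_inter, Measure.count_injective_image]
  exact fun s t h => sub_left_injective (A.injective h)

/-- An isometry `A` operator-close to `T` (within `1/(k+1)²`) moves vectors of norm `≤ k` by less
than `1/(k+1)`: `A v ∈ ball (T v) (1/(k+1))`. -/
theorem s2_mem_ball_of_norm_sub_lt
    (A : EuclideanSpace ℝ (Fin 3) →ₗᵢ[ℝ] EuclideanSpace ℝ (Fin 3))
    (T : EuclideanSpace ℝ (Fin 3) →L[ℝ] EuclideanSpace ℝ (Fin 3)) (k : ℕ)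
    (hAT : ‖A.toContinuousLinearMap - T‖ < 1 / (((k : ℝ) + 1) * ((k : ℝ) + 1)))
    (v : EuclideanSpace ℝ (Fin 3)) (hv : ‖v‖ ≤ k) :
    A v ∈ ball (T v) (1 / ((k : ℝ) + 1)) := by
  rw [mem_ball, dist_eq_norm]
  have h1 := (A.toContinuousLinearMap - T).le_opNorm v
  rw [sub_apply, LinearIsometry.coe_toContinuousLinearMap] at h1
  have h2 : ‖A.toContinuousLinearMap - T‖ * ‖v‖ ≤ 1 / (((k : ℝ) + 1) * ((k : ℝ) + 1)) * k :=
    mul_le_mul hAT.le hv (norm_nonneg _) (by positivity)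
  have h3 : 1 / (((k : ℝ) + 1) * ((k : ℝ) + 1)) * k < 1 / ((k : ℝ) + 1) := by
    rw [div_mul_eq_mul_div, one_mul, div_lt_div_iff₀ (by positivity) (by positivity)]
    nlinarith
  linarith

/-- **Sequential compactness of the isometry group**: a sequence of linear isometries of `ℝ³`
has a subsequence converging pointwise to a linear isometry (isometries form a closed bounded
subset of the proper operator space). -/
theorem s2_exists_subseq (x : ℕ → (EuclideanSpace ℝ (Fin 3) →L[ℝ] EuclideanSpace ℝ (Fin 3)))
    (hx : ∀ k v, ‖x k v‖ = ‖v‖) :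
    ∃ a : EuclideanSpace ℝ (Fin 3) →L[ℝ] EuclideanSpace ℝ (Fin 3), (∀ v, ‖a v‖ = ‖v‖) ∧
      ∃ φ : ℕ → ℕ, StrictMono φ ∧ ∀ v, Tendsto (fun j => x (φ j) v) atTop (𝓝 (a v)) := by
  have hcl : IsClosed {T : EuclideanSpace ℝ (Fin 3) →L[ℝ] EuclideanSpace ℝ (Fin 3) |
      ∀ v, ‖T v‖ = ‖v‖} := by
    rw [Set.setOf_forall]
    exact isClosed_iInter fun v => isClosed_eq (continuous_eval_const v).norm continuous_const
  have hbd : Bornology.IsBounded {T : EuclideanSpace ℝ (Fin 3) →L[ℝ] EuclideanSpace ℝ (Fin 3) |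
      ∀ v, ‖T v‖ = ‖v‖} := by
    refine (isBounded_closedBall (x := 0) (r := 1)).subset fun T hT => ?_
    rw [mem_closedBall_zero_iff]
    exact ContinuousLinearMap.opNorm_le_bound _ zero_le_one fun v => by rw [one_mul, hT v]
  obtain ⟨a, ha, φ, hφ, hlim⟩ := tendsto_subseq_of_bounded hbd (x := x) fun k => hx k
  rw [hcl.closure_eq] at ha
  exact ⟨a, ha, φ, hφ, fun v => ((continuous_eval_const v).tendsto a).comp hlim⟩

/-- **Extraction of the limiting copy.**  If the balls of `μ` around `0` have finite mass and,
for every `k`, the isometry `x k` places near every `x k (s - q)` (`s ∈ Y`, `dist s q ≤ k`) a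
`μ`-mass `≥ 1` within `1/(k+1)`, then for a pointwise limit `A` of a subsequence every
`A (s - q)`, `s ∈ Y`, is an atom of `μ` of mass `≥ 1`. -/
theorem s2_exists_limit_atoms (Y : Set (EuclideanSpace ℝ (Fin 3))) (q : EuclideanSpace ℝ (Fin 3))
    (μ : Measure (EuclideanSpace ℝ (Fin 3)))
    (hfinite : ∀ n : ℕ, μ (closedBall (0 : EuclideanSpace ℝ (Fin 3)) n) ≠ ⊤)
    (x : ℕ → (EuclideanSpace ℝ (Fin 3) →L[ℝ] EuclideanSpace ℝ (Fin 3)))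
    (hx : ∀ k v, ‖x k v‖ = ‖v‖)
    (hb : ∀ k : ℕ, ∀ s ∈ Y, dist s q ≤ k → 1 ≤ μ (ball (x k (s - q)) (1 / ((k : ℝ) + 1)))) :
    ∃ A : EuclideanSpace ℝ (Fin 3) →ₗᵢ[ℝ] EuclideanSpace ℝ (Fin 3), ∀ s ∈ Y, 1 ≤ μ {A (s - q)} := by
  obtain ⟨a, ha, φ, hφ, hlim⟩ := s2_exists_subseq x hx
  refine ⟨⟨(a : EuclideanSpace ℝ (Fin 3) →ₗ[ℝ] EuclideanSpace ℝ (Fin 3)), ha⟩, fun s hs => ?_⟩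
  show 1 ≤ μ {a (s - q)}
  set v := s - q with hv
  refine s2_one_le_measure_singleton μ (a v) ?_ fun m => ?_
  · -- the unit ball around `a v` sits inside a finite ball around `0`
    obtain ⟨n, hn⟩ := exists_nat_ge (‖v‖ + 1)
    refine ne_top_of_le_ne_top (hfinite n) (measure_mono fun y hy => ?_)
    rw [mem_closedBall_zero_iff]
    have := norm_le_of_mem_closedBall hy
    rw [ha v] at this
    linarith
  · -- a far enough term of the subsequence places mass `≥ 1` inside `closedBall (a v) (1/(m+1))`
    have hε : (0 : ℝ) < 1 / (2 * ((m : ℝ) + 1)) := by positivity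
    obtain ⟨J, hJ⟩ := Metric.tendsto_atTop.1 (hlim v) _ hε
    obtain ⟨j₀, hj₀⟩ := exists_nat_ge (max (2 * ((m : ℝ) + 1)) ‖v‖)
    set j := max J j₀ with hj
    have hJj : J ≤ j := le_max_left _ _
    have hj₀j : (j₀ : ℝ) ≤ φ j := by exact_mod_cast (le_max_right _ _).trans (hφ.id_le j)
    have hk1 : 2 * ((m : ℝ) + 1) ≤ φ j := ((le_max_left _ _).trans hj₀).trans hj₀j
    have hk2 : dist s q ≤ φ j := by
      rw [dist_eq_norm]
      exact ((le_max_right _ _).trans hj₀).trans hj₀j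
    have hdist : dist (x (φ j) v) (a v) < 1 / (2 * ((m : ℝ) + 1)) := hJ j hJj
    refine (hb (φ j) s hs hk2).trans (measure_mono fun y hy => ?_)
    rw [mem_ball] at hy
    rw [mem_closedBall]
    have hrad : 1 / ((φ j : ℝ) + 1) ≤ 1 / (2 * ((m : ℝ) + 1)) :=
      one_div_le_one_div_of_le (by positivity) (by linarith)
    have hsum : 1 / (2 * ((m : ℝ) + 1)) + 1 / (2 * ((m : ℝ) + 1)) = 1 / ((m : ℝ) + 1) := by
      field_simp
      ring
    calc dist y (a v) ≤ dist y (x (φ j) v) + dist (x (φ j) v) (a v) := dist_triangle _ _ _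
      _ ≤ 1 / (2 * ((m : ℝ) + 1)) + 1 / (2 * ((m : ℝ) + 1)) := by linarith
      _ = 1 / ((m : ℝ) + 1) := hsum

/-- **A countable dense family of linear isometries of `ℝ³`** (separability of the subset of
isometries of the second-countable operator space `E →L[ℝ] E`): every linear isometry is
operator-norm approximated by members of the family. -/
theorem s2_dense_family :
    ∃ 𝒜 : Set (EuclideanSpace ℝ (Fin 3) →L[ℝ] EuclideanSpace ℝ (Fin 3)), 𝒜.Countable ∧
      (∀ T ∈ 𝒜, ∀ v, ‖T v‖ = ‖v‖) ∧
      ∀ (A : EuclideanSpace ℝ (Fin 3) →ₗᵢ[ℝ] EuclideanSpace ℝ (Fin 3)) (ε : ℝ), 0 < ε →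
        ∃ T ∈ 𝒜, ‖A.toContinuousLinearMap - T‖ < ε := by
  obtain ⟨t, htI, htc, hIt⟩ := (TopologicalSpace.IsSeparable.of_separableSpace
    {T : EuclideanSpace ℝ (Fin 3) →L[ℝ] EuclideanSpace ℝ (Fin 3) | ∀ v, ‖T v‖ = ‖v‖})
      |>.exists_countable_dense_subset
  refine ⟨t, htc, fun T hT => htI hT, fun A ε hε => ?_⟩
  have hA : A.toContinuousLinearMap ∈ closure t := hIt fun v => A.norm_map v
  obtain ⟨T, hT, hd⟩ := Metric.mem_closure_iff.1 hA ε hε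
  exact ⟨T, hT, by rwa [dist_eq_norm] at hd⟩

/-! ### The registered stub -/

/-- **S2 — Giry measurability of a rooted isometry class.**  For a Delone set `D ⊆ ℝ³` and any
`q`, the class `{count|A(D − q) : A a linear isometry}` is measurable in
`MeasureTheory.Measure.instMeasurableSpace`: it is cut out by the countably many evaluation
conditions (a) `μ (closedBall 0 n) = count (D ∩ closedBall q n)` (`n : ℕ`) and (b) for each
`k : ℕ`, some member `T` of a countable dense family of isometries has
`1 ≤ μ (ball (T (s - q)) (1/(k+1)))` for all `s ∈ D ∩ closedBall q k`; the converse direction is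
the compactness extraction `s2_exists_limit_atoms` followed by the atom count
`s2_restrict_eq_count_restrict` on every ball. -/
theorem stub_measurableSet_isometryClass : ∀ (D : Delone.DeloneSet (EuclideanSpace ℝ (Fin 3))) (q : EuclideanSpace ℝ (Fin 3)), MeasurableSet {μ : MeasureTheory.Measure (EuclideanSpace ℝ (Fin 3)) | ∃ A : EuclideanSpace ℝ (Fin 3) →ₗᵢ[ℝ] EuclideanSpace ℝ (Fin 3), μ = (MeasureTheory.Measure.count : MeasureTheory.Measure (EuclideanSpace ℝ (Fin 3))).restrict ((fun s => A (s - q)) '' (D : Set (EuclideanSpace ℝ (Fin 3))))} := by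
  intro D q
  obtain ⟨𝒜, h𝒜c, h𝒜I, h𝒜d⟩ := s2_dense_family
  have hfin : ∀ r : ℝ, ((D : Set (EuclideanSpace ℝ (Fin 3))) ∩ closedBall q r).Finite :=
    s2_finite_inter D q
  -- the countable description
  set S : Set (Measure (EuclideanSpace ℝ (Fin 3))) :=
    (⋂ n : ℕ, {μ | μ (closedBall 0 n) =
        Measure.count ((D : Set (EuclideanSpace ℝ (Fin 3))) ∩ closedBall q n)}) ∩
      ⋂ k : ℕ, ⋃ T ∈ 𝒜, ⋂ s ∈ (D : Set (EuclideanSpace ℝ (Fin 3))) ∩ closedBall q k,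
        {μ | 1 ≤ μ (ball (T (s - q)) (1 / ((k : ℝ) + 1)))} with hS
  have hSm : MeasurableSet S := by
    refine (MeasurableSet.iInter fun n => ?_).inter (MeasurableSet.iInter fun k =>
      MeasurableSet.biUnion h𝒜c fun T _ => MeasurableSet.biInter (hfin k).countable fun s _ => ?_)
    · exact Measure.measurable_coe measurableSet_closedBall (measurableSet_singleton _)
    · exact Measure.measurable_coe measurableSet_ball measurableSet_Ici
  suffices heq : {μ : Measure (EuclideanSpace ℝ (Fin 3)) |
      ∃ A : EuclideanSpace ℝ (Fin 3) →ₗᵢ[ℝ] EuclideanSpace ℝ (Fin 3),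
        μ = (Measure.count : Measure (EuclideanSpace ℝ (Fin 3))).restrict
          ((fun s => A (s - q)) '' (D : Set (EuclideanSpace ℝ (Fin 3))))} = S by
    rw [heq]
    exact hSm
  ext μ
  simp only [hS, Set.mem_setOf_eq, Set.mem_inter_iff, Set.mem_iInter, Set.mem_iUnion,
    exists_prop]
  constructor
  · -- (⇒): a realised copy satisfies (a) and (b)
    rintro ⟨A, rfl⟩
    refine ⟨fun n => ?_, fun k => ?_⟩
    · rw [Measure.restrict_apply measurableSet_closedBall, s2_count_image_inter]
    · obtain ⟨T, hT, hAT⟩ := h𝒜d A (1 / (((k : ℝ) + 1) * ((k : ℝ) + 1))) (by positivity)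
      refine ⟨T, hT, fun s hs => ?_⟩
      rw [Measure.restrict_apply measurableSet_ball]
      have hmem : A (s - q) ∈ ball (T (s - q)) (1 / ((k : ℝ) + 1)) ∩
          (fun s => A (s - q)) '' (D : Set (EuclideanSpace ℝ (Fin 3))) :=
        ⟨s2_mem_ball_of_norm_sub_lt A T k hAT (s - q)
          (by rw [← dist_eq_norm]; exact mem_closedBall.1 hs.2), s, hs.1, rfl⟩
      calc (1 : ENNReal) = Measure.count ({A (s - q)} : Set (EuclideanSpace ℝ (Fin 3))) :=
            (Measure.count_singleton _).symm
        _ ≤ _ := measure_mono (Set.singleton_subset_iff.2 hmem)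
  · -- (⇐): extract the limiting copy and identify `μ` ball by ball
    rintro ⟨ha, hb⟩
    choose T hT𝒜 hT using hb
    have hfinite : ∀ n : ℕ, μ (closedBall (0 : EuclideanSpace ℝ (Fin 3)) n) ≠ ⊤ := fun n => by
      rw [ha n]
      exact (Measure.count_apply_lt_top.2 (hfin n)).ne
    obtain ⟨A, hA⟩ := s2_exists_limit_atoms (D : Set (EuclideanSpace ℝ (Fin 3))) q μ hfinite T
      (fun k => h𝒜I _ (hT𝒜 k)) (fun k s hs hsk => hT k s ⟨hs, mem_closedBall.2 hsk⟩)
    refine ⟨A, (Measure.ext_iff_of_iUnion_eq_univ (iUnion_closedBall_nat 0)).2 fun n => ?_⟩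
    rw [Measure.restrict_restrict measurableSet_closedBall]
    refine s2_restrict_eq_count_restrict μ ?_ Set.inter_subset_left ?_ ?_
    · rw [s2_image_inter]
      exact (hfin n).image _
    · rintro _ ⟨-, s, hs, rfl⟩
      exact hA s hs
    · rw [s2_count_image_inter]
      exact ha n

end Summit.AtomisticToContinuum.Crystallization.Theorems.IsometryAtomsAtomicLawChargesCrystal
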